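import Mathlib
import Summits.Ventures.PercRepro2.Defs
import Summits.Ventures.PercRepro2.Graph
import Summits.Ventures.PercRepro2.Induced
import Summits.Ventures.PercRepro2.VdBKahn
import Summits.Ventures.PercRepro2.ReimerVdBK
import Summits.Ventures.PercRepro2.ReimerVdBKRegions
import Summits.Ventures.PercRepro2.ReimerVdBKFlip
import Summits.Ventures.PercRepro2.ReimerVdBKTrivialCore

/-!
# The component flip is injective on every exact-core stratum
(blind cell PercRepro2, mine-c g47; `conjectures/MINE-C.md` §56.7, `proofs/MINEC-CORELATTICE.md` §4)

g44's component flip `Ψ` (`ReimerVdBKTrivialCore`: flip every edge touching the components of the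
world-2-private region that meet `B ∪ X`) maps the left event of (R-1.2) into the right event and is
injective on the trivial-core stratum.  Here: the flip never enlarges the core (`core_flipAt_subset`), the
world-1-private region of the image OUTSIDE THE OLD CORE is the old private region together with the flipped
part (`only1_flipAt_sdiff_core`), so the flipped part is recovered from the image once the preimage's core is
known (`hitSet_only1_Ψ_sdiff_core`) and `Ψ` is injective on every exact-core stratum of the left event
(`Ψ_injOn_stratum`).  THEOREM `count_stratum_le_count_coreSubset`: for every instance `(A, X; B, Y)` and every
vertex set `C`, `#{ω ∈ L : K₁ ∩ K₂ = C} ≤ #{ω ∈ R : K₁ ∩ K₂ ⊆ C}` — one exact-core stratum of the left event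
never exceeds the right event at or below it (`C = {s}` is g44's trivial-core theorem).  Census
(`MINE-C.md` §56.7): the within-stratum collisions of `Ψ` are `0` on every graph with ≤ 5 vertices; the
collisions across strata are what separates this theorem from (CORE↓).
-/

namespace Summit.Ventures.PercRepro2
namespace ReimerVdBK
open Classical

variable {V : Type*} {E : Type*} [Fintype E] [DecidableEq E] [Fintype V] [DecidableEq V]
variable (ends : E → Sym2 V) (s : V)

section General
variable {ω : Config E} {D : Set V}

omit [Fintype E] [DecidableEq E] [Fintype V] [DecidableEq V] in
/-- **The core never grows under a flip**: for `D ⊆ K₂ \ K₁` closed in `K₂ \ K₁`,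
`core (flipAt D ω) ⊆ core ω`. -/
theorem core_flipAt_subset (hD : D ⊆ only2 ends s ω)
    (hcl : ∀ e x y, ends e = s(x, y) → x ∈ D → y ∉ D → y ∉ only2 ends s ω) :
    core ends s (flipAt ends D ω) ⊆ core ends s ω := by
  intro v hv
  obtain ⟨hv1, hv2⟩ := hv
  have hv2' : v ∈ K₂ ends s ω \ D := K₂_flipAt_subset ends s hD hcl hv2
  have hv1' : v ∈ K₁ ends s ω ∪ D := by
    rw [← K₁_flipAt ends s hD hcl]
    exact hv1
  refine ⟨?_, hv2'.1⟩
  rcases hv1' with h | h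
  · exact h
  · exact absurd h hv2'.2

omit [Fintype E] [DecidableEq E] [Fintype V] [DecidableEq V] in
/-- **The world-1-private region of the flip, outside the old core, is the old private region together
with the flipped part**: `only1 (flipAt D ω) \ core ω = only1 ω ∪ D`. -/
theorem only1_flipAt_sdiff_core (hD : D ⊆ only2 ends s ω)
    (hcl : ∀ e x y, ends e = s(x, y) → x ∈ D → y ∉ D → y ∉ only2 ends s ω) :
    only1 ends s (flipAt ends D ω) \ core ends s ω = only1 ends s ω ∪ D := by
  ext v
  constructor
  · rintro ⟨hv1, hvc⟩
    have h1 : v ∈ K₁ ends s ω ∪ D := by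
      rw [← K₁_flipAt ends s hD hcl]
      exact hv1.1
    rcases h1 with h1 | h1
    · left
      refine ⟨h1, fun h2 => hvc ⟨h1, h2⟩⟩
    · right
      exact h1
  · rintro (⟨h1, h2⟩ | hvD)
    · refine ⟨⟨?_, fun h => h2 (K₂_flipAt_subset ends s hD hcl h).1⟩, fun h => h2 h.2⟩
      rw [K₁_flipAt ends s hD hcl]
      exact Or.inl h1
    · refine ⟨⟨?_, fun h => (K₂_flipAt_subset ends s hD hcl h).2 hvD⟩, fun h => (hD hvD).2 h.1⟩
      rw [K₁_flipAt ends s hD hcl]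
      exact Or.inr hvD

end General

section Injection
variable (B X : Finset V)

omit [Fintype E] [DecidableEq E] [Fintype V] in
/-- `Ψ` never enlarges the core. -/
theorem core_Ψ_subset (ω : Config E) : core ends s (Ψ ends s B X ω) ⊆ core ends s ω :=
  core_flipAt_subset ends s (flipSet_subset ends s B X ω) (flipSet_closed ends s B X ω)

omit [Fintype E] [DecidableEq E] [Fintype V] in
/-- **The flipped part is recovered from the image and the old core**: for `ω ∈ L`, the components of
`only1 (Ψ ω) \ core ω` meeting `B ∪ X` are exactly the flipped components. -/
theorem hitSet_only1_Ψ_sdiff_core {A Y : Finset V} {ω : Config E}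
    (hω : ω ∈ twoWorld ends s A X B Y) :
    hitSet ends (only1 ends s (Ψ ends s B X ω) \ core ends s ω) (B ∪ X) = flipSet ends s B X ω := by
  set D := flipSet ends s B X ω with hDdef
  have hD := flipSet_subset ends s B X ω
  have hcl := flipSet_closed ends s B X ω
  have h1 : only1 ends s (Ψ ends s B X ω) \ core ends s ω = only1 ends s ω ∪ D :=
    only1_flipAt_sdiff_core ends s hD hcl
  rw [mem_twoWorld_iff] at hω
  obtain ⟨hA, hX, hB, hY⟩ := hω
  have hBX : ∀ w ∈ B ∪ X, w ∉ only1 ends s ω := by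
    intro w hw hw1
    rcases Finset.mem_union.1 hw with hw | hw
    · exact ((mem_only1 ends s).1 hw1).2 (hB w hw)
    · exact hX w hw ((mem_only1 ends s).1 hw1).1
  have hclD : ∀ e x y, ends e = s(x, y) → x ∈ D → y ∈ only1 ends s ω ∪ D → y ∈ D := by
    intro e x y hends hx hy
    rcases hy with hy | hy
    · exfalso
      exact not_adj_only1_only2 ends s hy (hD hx) e (by rw [hends, Sym2.eq_swap])
    · exact hy
  rw [h1]
  ext v
  constructor
  · rintro ⟨hv, w, hw, hwS, hvw⟩
    have hwD : w ∈ D := by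
      rcases hwS with hwS | hwS
      · exact absurd hwS (hBX w hw)
      · exact hwS
    have hwv : GConn ends (only1 ends s ω ∪ D) w v := gconn_symm ends hvw
    exact mem_of_gconn ends hwD (gconn_of_closed ends hclD hwD hwv)
  · intro hv
    have hvD : v ∈ D := hv
    obtain ⟨hv2, w, hw, hw2, hvw⟩ := hv
    have hwD : w ∈ D := mem_hitSet_of_mem ends hw hw2
    have hclD' : ∀ e x y, ends e = s(x, y) → x ∈ D → y ∈ only2 ends s ω → y ∈ D :=
      fun _ _ _ hends hx hy => hitSet_closed ends hends hx hy
    have hvwD : GConn ends D v w := gconn_of_closed ends hclD' hvD hvw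
    exact ⟨Or.inr hvD, w, hw, Or.inr hwD, gconn_mono ends Set.subset_union_right hvwD⟩

omit [Fintype E] [DecidableEq E] [Fintype V] in
/-- **`Ψ` is injective on every exact-core stratum of `L`.** -/
theorem Ψ_injOn_stratum {A Y : Finset V} {ω ω' : Config E}
    (hω : ω ∈ twoWorld ends s A X B Y) (hω' : ω' ∈ twoWorld ends s A X B Y)
    (hc : core ends s ω = core ends s ω') (h : Ψ ends s B X ω = Ψ ends s B X ω') : ω = ω' := by
  have hD : flipSet ends s B X ω = flipSet ends s B X ω' := by
    rw [← hitSet_only1_Ψ_sdiff_core ends s B X hω, ← hitSet_only1_Ψ_sdiff_core ends s B X hω', h,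
      hc]
  calc ω = flipAt ends (flipSet ends s B X ω) (Ψ ends s B X ω) := (flipAt_flipAt ends _ ω).symm
    _ = flipAt ends (flipSet ends s B X ω') (Ψ ends s B X ω') := by rw [hD, h]
    _ = ω' := flipAt_flipAt ends _ ω'

end Injection

/-! ## The stratum inequality -/

omit [Fintype V] in
/-- **One exact-core stratum of the left event never exceeds the right event at or below it**: for every
instance `(A, X; B, Y)` and every vertex set `C`,
`#{ω ∈ twoWorld A X B Y : K₁ ∩ K₂ = C} ≤ #{ω ∈ twoWorld (A ∪ B) (X ∩ Y) ∅ (X ∪ Y) : K₁ ∩ K₂ ⊆ C}`. -/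
theorem count_stratum_le_count_coreSubset (A X B Y : Finset V) (C : Set V) :
    count (twoWorld ends s A X B Y ∩ {ω | core ends s ω = C}) ≤
      count (twoWorld ends s (A ∪ B) (X ∩ Y) ∅ (X ∪ Y) ∩ {ω | core ends s ω ⊆ C}) := by
  rw [count_eq_card, count_eq_card]
  refine Finset.card_le_card_of_injOn (Ψ ends s B X) ?_ ?_
  · intro ω hω
    simp only [Finset.coe_filter, Finset.mem_univ, true_and, Set.mem_setOf_eq, Set.mem_inter_iff] at hω ⊢
    refine ⟨Ψ_mem_twoWorld ends s B X hω.1, ?_⟩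
    rw [← hω.2]
    exact core_Ψ_subset ends s B X ω
  · intro ω hω ω' hω' h
    simp only [Finset.coe_filter, Finset.mem_univ, true_and, Set.mem_setOf_eq, Set.mem_inter_iff] at hω hω'
    exact Ψ_injOn_stratum ends s B X hω.1 hω'.1 (hω.2.trans hω'.2.symm) h

end ReimerVdBK
end Summit.Ventures.PercRepro2
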